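import Literature.AlgebraicGeometry.Frobenioids.BiratUnitsPush
import Literature.AlgebraicGeometry.Frobenioids.PreFrobenioidEquivalence
import HarnessLib

/-!
# Frobenioids I, Proposition 4.4 (iv) / Corollary 4.10: the rational function monoid `O^×(A^birat)` is
# transported by an equivalence of Frobenioids

Mochizuki, *The geometry of Frobenioids I: the general theory*, Kyushu J. Math. **62** (2008) 293–400, §4,
Prop. 4.4 (iv), kurims text p. 83 (base-identity automorphisms of `A^birat` as fractions `(α, φ)` of
base-equivalent co-angular pre-steps `α, φ : A' → A`), and Cor. 4.10, p. 90 [cite: MochizukiFrdI2008, Cor. 4.10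
p.90]: "Then `Ψ` induces a 1-unique functor `Ψ^birat : C₁^birat → C₂^birat` …" — in particular `Ψ^birat`
carries `O^×(A^birat) ⊆ Aut_{C₁^birat}(A^birat)` to `O^×(Ψ(A)^birat)`.

What this file does (our words, not print's).  abc-iut-L1-t2's EXPLICIT description `PreFrobenioid.BiratUnits F
hF A` of `O^×(A^birat)` (`BiratUnits.lean`: classes of fractions `(α, φ)` of base-equivalent co-angular pre-steps
into `A` modulo common refinement) is manifestly functorial along an equivalence `Ψ : C₁ ⥲ C₂` of Frobenioids
that preserves co-angular pre-steps ([FrdI] Thm. 3.4 (ii); PROVED over FSM-type bases by abc-iut-L1-t13,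
`FrdI.isCoAngularPreStep_map_of_quasiIsotropic_of_isOfFSMType`) and base-equivalent pairs (Thm. 3.4 (v), i.e.
the existence of `Ψ^Base`): apply `Ψ` to numerator, denominator and refinement data.
* `RatFrac.mapEquiv`, `RatFrac.Refinement.mapEquiv` — `Ψ` on fractions / refinement data; respects the
  refinement relation (`mapEquiv_rel`), products (`mapEquiv_mulWith_rel`), the unit, and the push-forward along
  co-angular pre-steps of `BiratUnitsPush.lean` (`mapEquiv_push_rel`);
* `BiratUnits.mapEquiv : O^×(A^birat) →* O^×(Ψ(A)^birat)`, `[(α, φ)] ↦ [(Ψ α, Ψ φ)]` (`mapEquiv_mk`), commuting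
  with `BiratUnits.push` (`mapEquiv_push`);
* if moreover `Ψ⁻¹` preserves co-angular pre-steps and base-equivalent pairs, `mapEquiv` is bijective
  (`mapEquiv_injective`, `mapEquiv_surjective`: pull a refinement / a fraction back along `Ψ⁻¹` and the unit
  `1 ≅ Ψ⁻¹Ψ`), whence the group isomorphism `BiratUnits.equivOfEquiv : O^×(A^birat) ≃ O^×(Ψ(A)^birat)` — the
  units clause of Cor. 4.10 in the explicit Prop. 4.4 (iv) description (the functor-level `Ψ^birat` is
  abc-iut-L1-t10's `Birat.mapOfEquiv`, `BirationalizationCategoryTheoreticity.lean`; not used here).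
Proof-only apart from the three transport maps; no statement of the paper is restated or strengthened; nothing
here is specific to the abc programme (consumer: [EtTh] Thm 4.4 (ii) at the model, `Ψ^birat` on `O^×(A^birat)`,
`Literature/AnabelianGeometry/EtaleTheta/BiKummerThm44SubModelBirat.lean`).
-/

namespace Literature.AlgebraicGeometry.Frobenioids

open CategoryTheory Opposite

universe w₁ v₁ v₁' u₁ u₁' w₂ v₂ v₂' u₂ u₂'

namespace PreFrobenioid

variable {D₁ : Type u₁} [Category.{v₁} D₁] {Φ₁ : D₁ᵒᵖ ⥤ CommMonCat.{w₁}}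
  {C₁ : Type u₁'} [Category.{v₁'} C₁] {F₁ : C₁ ⥤ ElemFrobenioid Φ₁}
  {D₂ : Type u₂} [Category.{v₂} D₂] {Φ₂ : D₂ᵒᵖ ⥤ CommMonCat.{w₂}}
  {C₂ : Type u₂'} [Category.{v₂'} C₂] {F₂ : C₂ ⥤ ElemFrobenioid Φ₂}

/-- An isomorphism of a Frobenioid is a co-angular pre-step (co-angular since a Frobenioid is totally
epimorphic, [FrdI] §0 p. 16; a pre-step by Rem. 1.1.1). [cite: MochizukiFrdI2008, Def. 1.2 (iii) p.22] -/
theorem IsFrobenioid.isCoAngularPreStep_of_isIso (hF : IsFrobenioid F₁) {A B : C₁} (φ : A ⟶ B) [IsIso φ] :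
    IsCoAngularPreStep F₁ φ :=
  ⟨isCoAngular_of_isIso_of_isTotallyEpimorphic F₁ hF.isPreFrobenioid.isTotallyEpimorphic φ,
    isPreStep_of_isIso F₁ φ⟩

section Map

variable (Ψ : C₁ ≌ C₂)
  (hΨ : ∀ ⦃A B : C₁⦄ (f : A ⟶ B), IsCoAngularPreStep F₁ f → IsCoAngularPreStep F₂ (Ψ.functor.map f))
  (hb : ∀ ⦃A B : C₁⦄ (f g : A ⟶ B), BaseEquivalent F₁ f g →
    BaseEquivalent F₂ (Ψ.functor.map f) (Ψ.functor.map g))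

namespace RatFrac

variable {A : C₁}

/-- `Ψ` on fractions: `(α, φ) ↦ (Ψ α, Ψ φ)` — a fraction at `Ψ(A)` when `Ψ` preserves co-angular pre-steps and
base-equivalent pairs. [cite: MochizukiFrdI2008, Prop. 4.4 (iv) p.83] -/
def mapEquiv (p : RatFrac F₁ A) : RatFrac F₂ (Ψ.functor.obj A) where
  src := Ψ.functor.obj p.src
  den := Ψ.functor.map p.den
  num := Ψ.functor.map p.num
  den_mem := hΨ _ p.den_mem
  num_mem := hΨ _ p.num_mem
  baseEq := hb _ _ p.baseEq

/-- The common domain of `Ψ(α, φ)` is `Ψ` of that of `(α, φ)`. [cite: MochizukiFrdI2008, Prop. 4.4 (iv) p.83] -/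
@[simp] theorem mapEquiv_src (p : RatFrac F₁ A) : (p.mapEquiv Ψ hΨ hb).src = Ψ.functor.obj p.src := rfl

/-- The denominator of `Ψ(α, φ)` is `Ψ α`. [cite: MochizukiFrdI2008, Prop. 4.4 (iv) p.83] -/
@[simp] theorem mapEquiv_den (p : RatFrac F₁ A) : (p.mapEquiv Ψ hΨ hb).den = Ψ.functor.map p.den := rfl

/-- The numerator of `Ψ(α, φ)` is `Ψ φ`. [cite: MochizukiFrdI2008, Prop. 4.4 (iv) p.83] -/
@[simp] theorem mapEquiv_num (p : RatFrac F₁ A) : (p.mapEquiv Ψ hΨ hb).num = Ψ.functor.map p.num := rfl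

/-- `Ψ` on fractions respects the refinement relation (apply `Ψ` to the refining pre-steps).
[cite: MochizukiFrdI2008, Prop. 4.4 p.82] -/
theorem mapEquiv_rel {p q : RatFrac F₁ A} (h : Rel p q) : Rel (p.mapEquiv Ψ hΨ hb) (q.mapEquiv Ψ hΨ hb) := by
  obtain ⟨E, ε, ε', hε, hε', h₁, h₂⟩ := h
  refine ⟨Ψ.functor.obj E, Ψ.functor.map ε, Ψ.functor.map ε', hΨ _ hε, hΨ _ hε', ?_, ?_⟩
  · change Ψ.functor.map ε ≫ Ψ.functor.map p.den = Ψ.functor.map ε' ≫ Ψ.functor.map q.den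
    rw [← Functor.map_comp, h₁, Functor.map_comp]
  · change Ψ.functor.map ε ≫ Ψ.functor.map p.num = Ψ.functor.map ε' ≫ Ψ.functor.map q.num
    rw [← Functor.map_comp, h₂, Functor.map_comp]

/-- `Ψ` on refinement data for a product of fractions. [cite: MochizukiFrdI2008, Prop. 4.4 (i) p.84] -/
def Refinement.mapEquiv {p q : RatFrac F₁ A} (R : Refinement p q) :
    Refinement (p.mapEquiv Ψ hΨ hb) (q.mapEquiv Ψ hΨ hb) where
  apex := Ψ.functor.obj R.apex
  left := Ψ.functor.map R.left
  right := Ψ.functor.map R.right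
  left_mem := hΨ _ R.left_mem
  right_mem := hΨ _ R.right_mem
  w := by
    change Ψ.functor.map R.left ≫ Ψ.functor.map p.num = Ψ.functor.map R.right ≫ Ψ.functor.map q.den
    rw [← Functor.map_comp, R.w, Functor.map_comp]

/-- `Ψ` of a product fraction is the product of the images, computed with the image refinement datum (equal
up to the functoriality `Ψ(κ ≫ α) = Ψ κ ≫ Ψ α`, hence refinement-related). [cite: MochizukiFrdI2008, Prop. 4.4 (i) p.84] -/
theorem mapEquiv_mulWith_rel (hF₁ : IsFrobenioid F₁) (hF₂ : IsFrobenioid F₂) (p q : RatFrac F₁ A)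
    (R : Refinement p q) :
    Rel ((mulWith hF₁ p q R).mapEquiv Ψ hΨ hb)
      (mulWith hF₂ (p.mapEquiv Ψ hΨ hb) (q.mapEquiv Ψ hΨ hb) (R.mapEquiv Ψ hΨ hb)) := by
  refine ⟨Ψ.functor.obj R.apex, 𝟙 _, 𝟙 _, isCoAngularPreStep_id hF₂ _, isCoAngularPreStep_id hF₂ _, ?_, ?_⟩
  · change 𝟙 _ ≫ Ψ.functor.map (R.left ≫ p.den) = 𝟙 _ ≫ Ψ.functor.map R.left ≫ Ψ.functor.map p.den
    rw [Functor.map_comp]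
  · change 𝟙 _ ≫ Ψ.functor.map (R.right ≫ q.num) = 𝟙 _ ≫ Ψ.functor.map R.right ≫ Ψ.functor.map q.num
    rw [Functor.map_comp]

/-- `Ψ` of the unit fraction `(id, id)` is refinement-related to the unit fraction at `Ψ(A)`.
[cite: MochizukiFrdI2008, Prop. 4.4 (i) p.84] -/
theorem mapEquiv_one_rel (hF₁ : IsFrobenioid F₁) (hF₂ : IsFrobenioid F₂) (A : C₁) :
    Rel ((one hF₁ A).mapEquiv Ψ hΨ hb) (one hF₂ (Ψ.functor.obj A)) := by
  refine ⟨Ψ.functor.obj A, 𝟙 _, 𝟙 _, isCoAngularPreStep_id hF₂ _, isCoAngularPreStep_id hF₂ _, ?_, ?_⟩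
  · change 𝟙 _ ≫ Ψ.functor.map (𝟙 A) = 𝟙 _ ≫ 𝟙 _
    rw [Ψ.functor.map_id]
  · change 𝟙 _ ≫ Ψ.functor.map (𝟙 A) = 𝟙 _ ≫ 𝟙 _
    rw [Ψ.functor.map_id]

/-- `Ψ` commutes with pushing fractions forward along a co-angular pre-step `ψ` (`BiratUnitsPush.lean`), up to
refinement: `Ψ(α ≫ ψ, φ ≫ ψ) ∼ (Ψ α ≫ Ψ ψ, Ψ φ ≫ Ψ ψ)`. [cite: MochizukiFrdI2008, Prop. 4.4 (iv) p.83] -/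
theorem mapEquiv_push_rel (hF₁ : IsFrobenioid F₁) (hF₂ : IsFrobenioid F₂) {A A' : C₁} (ψ : A ⟶ A')
    (hψ : IsCoAngularPreStep F₁ ψ) (p : RatFrac F₁ A) :
    Rel ((push hF₁ ψ hψ p).mapEquiv Ψ hΨ hb)
      (push hF₂ (Ψ.functor.map ψ) (hΨ ψ hψ) (p.mapEquiv Ψ hΨ hb)) := by
  refine ⟨Ψ.functor.obj p.src, 𝟙 _, 𝟙 _, isCoAngularPreStep_id hF₂ _, isCoAngularPreStep_id hF₂ _, ?_, ?_⟩
  · change 𝟙 _ ≫ Ψ.functor.map (p.den ≫ ψ) = 𝟙 _ ≫ Ψ.functor.map p.den ≫ Ψ.functor.map ψ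
    rw [Functor.map_comp]
  · change 𝟙 _ ≫ Ψ.functor.map (p.num ≫ ψ) = 𝟙 _ ≫ Ψ.functor.map p.num ≫ Ψ.functor.map ψ
    rw [Functor.map_comp]

end RatFrac

namespace BiratUnits

variable (hF₁ : IsFrobenioid F₁) (hF₂ : IsFrobenioid F₂)

/-- **`Ψ^birat` on `O^×(A^birat)`** in the explicit description of Prop. 4.4 (iv): the group homomorphism
`O^×(A^birat) → O^×(Ψ(A)^birat)`, `[(α, φ)] ↦ [(Ψ α, Ψ φ)]`, for an equivalence `Ψ` preserving co-angular
pre-steps and base-equivalent pairs. [cite: MochizukiFrdI2008, Cor. 4.10 p.90] -/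
def mapEquiv (A : C₁) : BiratUnits F₁ hF₁ A →* BiratUnits F₂ hF₂ (Ψ.functor.obj A) where
  toFun := Quotient.lift (s := RatFrac.setoid F₁ hF₁ A) (fun p => mk hF₂ (p.mapEquiv Ψ hΨ hb))
    fun _ _ h => sound (RatFrac.mapEquiv_rel Ψ hΨ hb h)
  map_one' := by
    change mk hF₂ ((RatFrac.one hF₁ A).mapEquiv Ψ hΨ hb) = mk hF₂ (RatFrac.one hF₂ (Ψ.functor.obj A))
    exact sound (RatFrac.mapEquiv_one_rel Ψ hΨ hb hF₁ hF₂ A)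
  map_mul' x y := by
    obtain ⟨p, rfl⟩ := mk_surjective x
    obtain ⟨q, rfl⟩ := mk_surjective y
    rw [mk_mul_mk_eq p q (RatFrac.someRefinement hF₁ q p)]
    change mk hF₂ ((RatFrac.mulWith hF₁ q p (RatFrac.someRefinement hF₁ q p)).mapEquiv Ψ hΨ hb) =
      mk hF₂ (p.mapEquiv Ψ hΨ hb) * mk hF₂ (q.mapEquiv Ψ hΨ hb)
    rw [mk_mul_mk_eq (p.mapEquiv Ψ hΨ hb) (q.mapEquiv Ψ hΨ hb)
      ((RatFrac.someRefinement hF₁ q p).mapEquiv Ψ hΨ hb)]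
    exact sound (RatFrac.mapEquiv_mulWith_rel Ψ hΨ hb hF₁ hF₂ q p _)

/-- `Ψ^birat` on the class of a fraction. [cite: MochizukiFrdI2008, Cor. 4.10 p.90] -/
@[simp] theorem mapEquiv_mk (A : C₁) (p : RatFrac F₁ A) :
    mapEquiv Ψ hΨ hb hF₁ hF₂ A (mk hF₁ p) = mk hF₂ (p.mapEquiv Ψ hΨ hb) := rfl

/-- `Ψ^birat` commutes with the transport of `O^×(−)` along co-angular pre-steps (Prop. 2.2 (ii)(b) for
`C^birat`, `BiratUnits.push`): `Ψ^birat(ψ · u) = Ψ(ψ) · Ψ^birat(u)`. [cite: MochizukiFrdI2008, Cor. 4.10 p.90] -/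
theorem mapEquiv_push {A A' : C₁} (ψ : A ⟶ A') (hψ : IsCoAngularPreStep F₁ ψ) (x : BiratUnits F₁ hF₁ A) :
    mapEquiv Ψ hΨ hb hF₁ hF₂ A' (push hF₁ ψ hψ x) =
      push hF₂ (Ψ.functor.map ψ) (hΨ ψ hψ) (mapEquiv Ψ hΨ hb hF₁ hF₂ A x) := by
  obtain ⟨p, rfl⟩ := mk_surjective x
  rw [push_mk, mapEquiv_mk, mapEquiv_mk, push_mk]
  exact sound (RatFrac.mapEquiv_push_rel Ψ hΨ hb hF₁ hF₂ ψ hψ p)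

section Bijective

variable
  (hΨ' : ∀ ⦃A B : C₂⦄ (f : A ⟶ B), IsCoAngularPreStep F₂ f → IsCoAngularPreStep F₁ (Ψ.inverse.map f))
  (hb' : ∀ ⦃A B : C₂⦄ (f g : A ⟶ B), BaseEquivalent F₂ f g →
    BaseEquivalent F₁ (Ψ.inverse.map f) (Ψ.inverse.map g))

include hΨ' in
/-- `Ψ^birat` on `O^×(A^birat)` is injective when `Ψ⁻¹` preserves co-angular pre-steps: a common refinement of
`Ψ(α, φ)`, `Ψ(α', φ')` pulls back along `Ψ⁻¹` and the unit `Ψ⁻¹Ψ ≅ 1` to one of `(α, φ)`, `(α', φ')`.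
[cite: MochizukiFrdI2008, Cor. 4.10 p.90] -/
theorem mapEquiv_injective (A : C₁) : Function.Injective (mapEquiv Ψ hΨ hb hF₁ hF₂ A) := by
  intro x y hxy
  obtain ⟨p, rfl⟩ := mk_surjective x
  obtain ⟨q, rfl⟩ := mk_surjective y
  rw [mapEquiv_mk, mapEquiv_mk, mk_eq_mk_iff] at hxy
  obtain ⟨E, ε, ε', hε, hε', h₁, h₂⟩ := hxy
  have h₁' : ε ≫ Ψ.functor.map p.den = ε' ≫ Ψ.functor.map q.den := h₁
  have h₂' : ε ≫ Ψ.functor.map p.num = ε' ≫ Ψ.functor.map q.num := h₂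
  -- moving a refinement of the images back along `Ψ⁻¹` and the unit `Ψ⁻¹Ψ ≅ 1`
  have key : ∀ {X : C₁} (δ : X ⟶ A) {E : C₂} (ε : E ⟶ Ψ.functor.obj X),
      (Ψ.inverse.map ε ≫ Ψ.unitInv.app X) ≫ δ =
        Ψ.inverse.map (ε ≫ Ψ.functor.map δ) ≫ Ψ.unitInv.app A := by
    intro X δ E ε
    have nat : (Ψ.inverse.map (Ψ.functor.map δ) ≫ Ψ.unitInv.app A : _ ⟶ A) = Ψ.unitInv.app X ≫ δ :=
      Ψ.unitInv.naturality δ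
    calc (Ψ.inverse.map ε ≫ Ψ.unitInv.app X) ≫ δ
        = Ψ.inverse.map ε ≫ (Ψ.unitInv.app X ≫ δ) := Category.assoc _ _ _
      _ = Ψ.inverse.map ε ≫ (Ψ.inverse.map (Ψ.functor.map δ) ≫ Ψ.unitInv.app A) :=
          congrArg (fun t => Ψ.inverse.map ε ≫ t) nat.symm
      _ = (Ψ.inverse.map ε ≫ Ψ.inverse.map (Ψ.functor.map δ)) ≫ Ψ.unitInv.app A :=
          (Category.assoc _ _ _).symm
      _ = Ψ.inverse.map (ε ≫ Ψ.functor.map δ) ≫ Ψ.unitInv.app A :=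
          congrArg (fun t => t ≫ Ψ.unitInv.app A) (Ψ.inverse.map_comp ε (Ψ.functor.map δ)).symm
  have hu : ∀ X : C₁, IsCoAngularPreStep F₁ (Ψ.unitInv.app X) := fun X =>
    hF₁.isCoAngularPreStep_of_isIso _
  apply sound
  refine ⟨Ψ.inverse.obj E, Ψ.inverse.map ε ≫ Ψ.unitInv.app p.src, Ψ.inverse.map ε' ≫ Ψ.unitInv.app q.src,
    (hΨ' _ hε).comp hF₁ (hu p.src), (hΨ' _ hε').comp hF₁ (hu q.src), ?_, ?_⟩
  · exact (key p.den ε).trans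
      ((congrArg (fun t => Ψ.inverse.map t ≫ Ψ.unitInv.app A) h₁').trans (key q.den ε').symm)
  · exact (key p.num ε).trans
      ((congrArg (fun t => Ψ.inverse.map t ≫ Ψ.unitInv.app A) h₂').trans (key q.num ε').symm)

include hΨ' hb' in
/-- `Ψ^birat` on `O^×(A^birat)` is surjective when `Ψ⁻¹` preserves co-angular pre-steps and base-equivalent
pairs: a fraction `(β, ψ)` at `Ψ(A)` is refinement-related (along the counit `ΨΨ⁻¹ ≅ 1`) to the image of
`(Ψ⁻¹β ≫ u, Ψ⁻¹ψ ≫ u)`, `u : Ψ⁻¹Ψ(A) ⥲ A` the unit. [cite: MochizukiFrdI2008, Cor. 4.10 p.90] -/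
theorem mapEquiv_surjective (A : C₁) : Function.Surjective (mapEquiv Ψ hΨ hb hF₁ hF₂ A) := by
  intro y
  obtain ⟨q, rfl⟩ := mk_surjective y
  have hu : IsCoAngularPreStep F₁ (Ψ.unitInv.app A) := hF₁.isCoAngularPreStep_of_isIso _
  have hc : IsCoAngularPreStep F₂ (Ψ.counit.app q.src) := hF₂.isCoAngularPreStep_of_isIso _
  -- `Ψ(Ψ⁻¹ f ≫ u_A) = c_Y ≫ f` (a triangle identity)
  have hmap : ∀ {Y : C₂} (f : Y ⟶ Ψ.functor.obj A),
      Ψ.functor.map (Ψ.inverse.map f ≫ Ψ.unitInv.app A) = Ψ.counit.app Y ≫ f := by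
    intro Y f
    have e₁ : Ψ.functor.map (Ψ.inverse.map f ≫ Ψ.unitInv.app A) =
        Ψ.functor.map (Ψ.inverse.map f) ≫ Ψ.functor.map (Ψ.unitInv.app A) := Ψ.functor.map_comp _ _
    have e₂ : Ψ.functor.map (Ψ.inverse.map f) ≫ Ψ.functor.map (Ψ.unitInv.app A) =
        Ψ.functor.map (Ψ.inverse.map f) ≫ Ψ.counit.app (Ψ.functor.obj A) :=
      congrArg (fun t => Ψ.functor.map (Ψ.inverse.map f) ≫ t) (Ψ.counit_app_functor A).symm
    have e₃ : Ψ.functor.map (Ψ.inverse.map f) ≫ Ψ.counit.app (Ψ.functor.obj A) = Ψ.counit.app Y ≫ f :=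
      Ψ.counit_naturality f
    exact e₁.trans (e₂.trans e₃)
  let p : RatFrac F₁ A :=
    { src := Ψ.inverse.obj q.src
      den := Ψ.inverse.map q.den ≫ Ψ.unitInv.app A
      num := Ψ.inverse.map q.num ≫ Ψ.unitInv.app A
      den_mem := (hΨ' _ q.den_mem).comp hF₁ hu
      num_mem := (hΨ' _ q.num_mem).comp hF₁ hu
      baseEq := by
        change Base F₁ (Ψ.inverse.map q.den ≫ Ψ.unitInv.app A) =
          Base F₁ (Ψ.inverse.map q.num ≫ Ψ.unitInv.app A)
        rw [base_comp, base_comp,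
          show Base F₁ (Ψ.inverse.map q.den) = Base F₁ (Ψ.inverse.map q.num) from hb' _ _ q.baseEq] }
  refine ⟨mk hF₁ p, ?_⟩
  rw [mapEquiv_mk]
  apply sound
  refine ⟨Ψ.functor.obj (Ψ.inverse.obj q.src), 𝟙 _, Ψ.counit.app q.src, isCoAngularPreStep_id hF₂ _, hc,
    ?_, ?_⟩
  · change 𝟙 _ ≫ Ψ.functor.map (Ψ.inverse.map q.den ≫ Ψ.unitInv.app A) = Ψ.counit.app q.src ≫ q.den
    exact (Category.id_comp _).trans (hmap q.den)
  · change 𝟙 _ ≫ Ψ.functor.map (Ψ.inverse.map q.num ≫ Ψ.unitInv.app A) = Ψ.counit.app q.src ≫ q.num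
    exact (Category.id_comp _).trans (hmap q.num)

/-- **Cor. 4.10 on units: `O^×(A^birat) ≃ O^×(Ψ(A)^birat)`** — `Ψ^birat` restricted to the rational function
monoid is an isomorphism of groups, for an equivalence `Ψ` such that `Ψ` and `Ψ⁻¹` preserve co-angular pre-steps
([FrdI] Thm. 3.4 (ii)) and base-equivalent pairs (Thm. 3.4 (v)). [cite: MochizukiFrdI2008, Cor. 4.10 p.90] -/
noncomputable def equivOfEquiv (A : C₁) : BiratUnits F₁ hF₁ A ≃* BiratUnits F₂ hF₂ (Ψ.functor.obj A) :=
  MulEquiv.ofBijective (mapEquiv Ψ hΨ hb hF₁ hF₂ A)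
    ⟨mapEquiv_injective Ψ hΨ hb hF₁ hF₂ hΨ' A, mapEquiv_surjective Ψ hΨ hb hF₁ hF₂ hΨ' hb' A⟩

/-- `equivOfEquiv` is `mapEquiv` on elements. [cite: MochizukiFrdI2008, Cor. 4.10 p.90] -/
@[simp] theorem equivOfEquiv_apply (A : C₁) (x : BiratUnits F₁ hF₁ A) :
    equivOfEquiv Ψ hΨ hb hF₁ hF₂ hΨ' hb' A x = mapEquiv Ψ hΨ hb hF₁ hF₂ A x := rfl

/-- `equivOfEquiv` on the class of a fraction. [cite: MochizukiFrdI2008, Cor. 4.10 p.90] -/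
theorem equivOfEquiv_mk (A : C₁) (p : RatFrac F₁ A) :
    equivOfEquiv Ψ hΨ hb hF₁ hF₂ hΨ' hb' A (mk hF₁ p) = mk hF₂ (p.mapEquiv Ψ hΨ hb) := rfl

/-- `equivOfEquiv` commutes with the transport along co-angular pre-steps. [cite: MochizukiFrdI2008, Cor. 4.10 p.90] -/
theorem equivOfEquiv_push {A A' : C₁} (ψ : A ⟶ A') (hψ : IsCoAngularPreStep F₁ ψ) (x : BiratUnits F₁ hF₁ A) :
    equivOfEquiv Ψ hΨ hb hF₁ hF₂ hΨ' hb' A' (push hF₁ ψ hψ x) =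
      push hF₂ (Ψ.functor.map ψ) (hΨ ψ hψ) (equivOfEquiv Ψ hΨ hb hF₁ hF₂ hΨ' hb' A x) :=
  mapEquiv_push Ψ hΨ hb hF₁ hF₂ ψ hψ x

end Bijective

end BiratUnits

end Map

end PreFrobenioid

end Literature.AlgebraicGeometry.Frobenioids
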